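import Mathlib

/-! # Route CapacityClassicality — tower factorisation (stub for crux stmt-Langlands-8927, line Sketch)

Exact `T_ℓ`-eigenness (in `q`-expansion form) for every prime `ℓ ∤ N p`, together with the
normalisation `b 1 = 1`, forces `b (n * m) = b n * b m` whenever `n` is coprime to `N p` and every
prime factor of `m` divides `N p`.  In other words the series `Σ b n qⁿ` is the tower
`Σ_{m ∣ (N p)^∞} b m · g♭(q ^ m)` over its `N p`-depleted part `g♭`.  Pure algebra: strong
induction on `n`, peeling off one prime factor `ℓ ∣ n` at a time with the `T_ℓ`-relation.
-/

set_option linter.dupNamespace false -- `Summit.Langlands.Langlands` is the mandated namespace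

namespace Summit.Langlands.Langlands.Theorems.CapacityClassicality

/-- **Tower factorisation.** If `b 1 = 1` and `b` satisfies the exact `T_ℓ`-eigen relation
`b (ℓ n) + [ℓ ∣ n] ψ ℓ ℓ^(k-1) b (n / ℓ) = b ℓ * b n` for every prime `ℓ ∤ N p` and every `n > 0`,
then `b (n * m) = b n * b m` for all `m, n > 0` with `n` coprime to `N p` and every prime factor
of `m` dividing `N p`.  Proof: strong induction on `n`; for `n = ℓ n₁` with `ℓ` prime, apply the
relation at `n₁ m` and at `n₁` (note `ℓ ∤ m`) and use the induction hypothesis at `n₁` and, when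
`ℓ ∣ n₁`, at `n₁ / ℓ`. [folklore] -/
theorem towerFactorisation (N p : ℕ) (k : ℤ) (ψ : DirichletCharacter ℂ N) (b : ℕ → ℂ)
    (h1 : b 1 = 1)
    (hT : ∀ ℓ n : ℕ, ℓ.Prime → ¬ ℓ ∣ N * p → 0 < n →
      b (ℓ * n) + (if ℓ ∣ n then ψ ℓ * (ℓ : ℂ) ^ (k - 1) * b (n / ℓ) else 0) = b ℓ * b n) :
    ∀ m n : ℕ, 0 < m → 0 < n → Nat.Coprime n (N * p) →
      (∀ q : ℕ, q.Prime → q ∣ m → q ∣ N * p) → b (n * m) = b n * b m := by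
  intro m n hm hn hcop hsupp
  induction n using Nat.strong_induction_on with
  | _ n ih =>
    rcases eq_or_ne n 1 with rfl | hn1
    · rw [one_mul, h1, one_mul]
    · obtain ⟨ℓ, hℓ, hℓn⟩ := Nat.exists_prime_and_dvd hn1
      obtain ⟨n₁, rfl⟩ := hℓn
      -- `ℓ ∤ N p` since `ℓ ∣ n` and `n` is coprime to `N p`; hence also `ℓ ∤ m`.
      have hℓNp : ¬ ℓ ∣ N * p :=
        (Nat.Prime.coprime_iff_not_dvd hℓ).1
          (Nat.Coprime.coprime_dvd_left (dvd_mul_right ℓ n₁) hcop)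
      have hℓm : ¬ ℓ ∣ m := fun h => hℓNp (hsupp ℓ hℓ h)
      have hn₁ : 0 < n₁ := pos_of_mul_pos_right hn (Nat.zero_le ℓ)
      have hn₁lt : n₁ < ℓ * n₁ := lt_mul_left hn₁ hℓ.one_lt
      have hcop₁ : Nat.Coprime n₁ (N * p) :=
        Nat.Coprime.coprime_dvd_left (dvd_mul_left n₁ ℓ) hcop
      have ih₁ : b (n₁ * m) = b n₁ * b m := ih n₁ hn₁lt hn₁ hcop₁
      have e1 := hT ℓ (n₁ * m) hℓ hℓNp (Nat.mul_pos hn₁ hm)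
      have e2 := hT ℓ n₁ hℓ hℓNp hn₁
      rw [mul_assoc]
      by_cases hd : ℓ ∣ n₁
      · -- `n₁ = ℓ n₂`: both correction terms are present.
        obtain ⟨n₂, rfl⟩ := hd
        have hn₂ : 0 < n₂ := pos_of_mul_pos_right hn₁ (Nat.zero_le ℓ)
        have hn₂lt : n₂ < ℓ * (ℓ * n₂) := (lt_mul_left hn₂ hℓ.one_lt).trans hn₁lt
        have hcop₂ : Nat.Coprime n₂ (N * p) :=
          Nat.Coprime.coprime_dvd_left ((dvd_mul_left n₂ ℓ).trans (dvd_mul_left (ℓ * n₂) ℓ)) hcop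
        have ih₂ : b (n₂ * m) = b n₂ * b m := ih n₂ hn₂lt hn₂ hcop₂
        have hdm : ℓ ∣ ℓ * n₂ * m := ⟨n₂ * m, by ring⟩
        have hdiv₁ : ℓ * n₂ * m / ℓ = n₂ * m := by
          rw [mul_assoc]
          exact Nat.mul_div_cancel_left _ hℓ.pos
        have hdiv₂ : ℓ * n₂ / ℓ = n₂ := Nat.mul_div_cancel_left _ hℓ.pos
        rw [if_pos hdm, hdiv₁] at e1
        rw [if_pos (dvd_mul_right ℓ n₂), hdiv₂] at e2
        linear_combination e1 - b m * e2 - (ψ ℓ * (ℓ : ℂ) ^ (k - 1)) * ih₂ + b ℓ * ih₁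
      · -- `ℓ ∤ n₁`: no correction terms (as `ℓ ∤ m` too).
        have hdm : ¬ ℓ ∣ n₁ * m := fun h => hd (((Nat.Prime.dvd_mul hℓ).1 h).resolve_right hℓm)
        rw [if_neg hdm] at e1
        rw [if_neg hd] at e2
        linear_combination e1 - b m * e2 + b ℓ * ih₁

/-- **Tower factorisation**, under the name registered for the stub of line `Sketch`
(crux `stmt-Langlands-8927`): verbatim restatement of `towerFactorisation`. [folklore] -/
theorem stub_towerFactorisation (N p : ℕ) (k : ℤ) (ψ : DirichletCharacter ℂ N) (b : ℕ → ℂ)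
    (h1 : b 1 = 1)
    (hT : ∀ ℓ n : ℕ, ℓ.Prime → ¬ ℓ ∣ N * p → 0 < n →
      b (ℓ * n) + (if ℓ ∣ n then ψ ℓ * (ℓ : ℂ) ^ (k - 1) * b (n / ℓ) else 0) = b ℓ * b n) :
    ∀ m n : ℕ, 0 < m → 0 < n → Nat.Coprime n (N * p) →
      (∀ q : ℕ, q.Prime → q ∣ m → q ∣ N * p) → b (n * m) = b n * b m :=
  towerFactorisation N p k ψ b h1 hT

end Summit.Langlands.Langlands.Theorems.CapacityClassicality
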